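import Summits.CriticalPhenomena.CardyFormulaZ2.Theorems.CardyIKTransportIKLinearTransportStubRowCFTPRemains

/-!
# Stub `stub_CoalescingRowKernel` (A_dyn') — part S: THE ROW SAMPLER (quantile of eight weights with a
# RESIDUAL LEVEL)

Support file (`--supports stmt-CriticalPhenomena-5076`, registered sub-goal `crk_rowSampler_law`).
The row kernel `G (t, r)` of (A_dyn') receives ONE uniform level `r = U (i+1, 0) u` and must output a whole
configuration whose law, jointly with the row statistic `t = rowStat i x`, is that of `(rowStat i x, x)`;
the coalescence argument needs its ROW-`0` BITS to be an explicit quantile of a kernel `k t ·` (a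
probability vector on the eight row values), while the rows above row `0` are delegated to an abstract tail
kernel (`ps3_transfer_kernel`), which needs a uniform level INDEPENDENT of the sampled row. Both are read
from the single level: `crkPick ws r` selects the index `j` with `c_j < r ≤ c_{j+1}` (prefix sums `c`) and
`crkResid ws r = (r - c_j)/w_j` is the residual level; `{pick = j, resid ≤ s} = (c_j, c_j + s w_j]`
(`crk_pick_resid_set`), so under a uniform level (selection, residual) has the law (weights) ⊗ uniform
(`crk_measure_pick_resid`). Specialised to the eight row values in a fixed order (`crkVals`): the row
sampler `crkQ k (t, r)`, its residual `crkR k (t, r)`, their joint measurability in `(t, r)` when `k` is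
measurable in `t`, and the registered ONE-DIMENSIONAL LAW
`β {crkQ = b, crkR ≤ a} = clamp(a) · k t b` (`crk_rowSampler_law`). Also: the Boolean reading `rowBool` of
the three middle bits of row `0` and `setMid i 0 x (toProp (rowBool i x)) = x`.
-/

noncomputable section

namespace Summit.CriticalPhenomena.CardyFormulaZ2.Theorems.IKLinearTransport.PinnedDiagramExchange

open scoped Classical MeasureTheory ENNReal symmDiff
open Set MeasureTheory
open Literature.Probability.Percolation Literature.Probability.LatticeModels


/-! ## Quantile sampling from a finite list of weights, with the residual level -/

/-- The index selected by the level `r` for the weights `ws`: the `j` with `c_j < r ≤ c_{j+1}`,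
`c_j` the prefix sums. [folklore] -/
def crkPick : List ℝ → ℝ → ℕ
  | [], _ => 0
  | w :: ws, r => if r ≤ w then 0 else crkPick ws (r - w) + 1

/-- The RESIDUAL LEVEL `(r - c_j)/w_j ∈ (0,1]` of the selected index: uniform and independent of the
selection when `r` is. [folklore] -/
def crkResid : List ℝ → ℝ → ℝ
  | [], r => r
  | w :: ws, r => if r ≤ w then r / w else crkResid ws (r - w)

/-- Prefix sums of the weights. [folklore] -/
def crkCum (ws : List ℝ) (j : ℕ) : ℝ := (ws.take j).sum

/-- THE SELECTION EVENT IS AN INTERVAL: for nonnegative weights, `{0 < r, pick = j, resid ≤ s}` is the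
interval `(c_j, c_j + s w_j]`. [folklore] -/
theorem crk_pick_resid_set : ∀ (ws : List ℝ), (∀ w ∈ ws, 0 ≤ w) → ∀ (j : ℕ), j < ws.length →
    ∀ (s : ℝ), 0 ≤ s → s ≤ 1 →
      {r : ℝ | 0 < r ∧ crkPick ws r = j ∧ crkResid ws r ≤ s} = Ioc (crkCum ws j) (crkCum ws j + s * ws.getD j 0)
  | [], _, j, hj, _, _, _ => by simp at hj
  | w :: ws, hw, 0, _, s, hs0, hs1 => by
    have hw0 : 0 ≤ w := hw w List.mem_cons_self
    ext r
    simp only [crkPick, crkResid, crkCum, List.take_zero, List.sum_nil, List.getD_cons_zero, mem_setOf_eq,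
      mem_Ioc, zero_add]
    constructor
    · rintro ⟨hr, hp, hq⟩
      by_cases hrw : r ≤ w
      · rw [if_pos hrw] at hq
        have hwpos : 0 < w := hr.trans_le hrw
        exact ⟨hr, by rwa [div_le_iff₀ hwpos] at hq⟩
      · rw [if_neg hrw] at hp; simp at hp
    · rintro ⟨hr, hrs⟩
      have hrw : r ≤ w := hrs.trans (by nlinarith)
      refine ⟨hr, by rw [if_pos hrw], ?_⟩
      rw [if_pos hrw]
      have hwpos : 0 < w := hr.trans_le hrw
      rwa [div_le_iff₀ hwpos]
  | w :: ws, hw, j + 1, hj, s, hs0, hs1 => by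
    have hw' : ∀ w' ∈ ws, 0 ≤ w' := fun w' h => hw w' (List.mem_cons_of_mem _ h)
    have hj' : j < ws.length := by simpa using hj
    have ih := crk_pick_resid_set ws hw' j hj' s hs0 hs1
    ext r
    simp only [crkPick, crkResid, crkCum, List.take_succ_cons, List.sum_cons, List.getD_cons_succ, mem_setOf_eq,
      mem_Ioc]
    have ihr := Set.ext_iff.1 ih (r - w)
    simp only [mem_setOf_eq, mem_Ioc, crkCum] at ihr
    constructor
    · rintro ⟨hr, hp, hq⟩
      by_cases hrw : r ≤ w
      · rw [if_pos hrw] at hp; simp at hp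
      · rw [if_neg hrw] at hp hq
        have h1 := ihr.1 ⟨by linarith, by simpa using hp, hq⟩
        constructor <;> linarith [h1.1, h1.2]
    · rintro ⟨h1, h2⟩
      have hcum : 0 ≤ (ws.take j).sum := List.sum_nonneg fun x hx => hw' x (List.mem_of_mem_take hx)
      have hw0 : 0 ≤ w := hw w List.mem_cons_self
      have hrw : ¬ r ≤ w := fun h => by linarith
      have h3 := ihr.2 ⟨by linarith, by linarith⟩
      refine ⟨by linarith, ?_, ?_⟩
      · rw [if_neg hrw, h3.2.1]
      · rw [if_neg hrw]; exact h3.2.2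

/-- The selected index is in range when the level does not exceed the total weight. [folklore] -/
theorem crk_pick_lt_length : ∀ (w : ℝ) (ws : List ℝ) (r : ℝ), r ≤ (w :: ws).sum →
    crkPick (w :: ws) r < (w :: ws).length
  | w, [], r, hr => by
    simp only [List.sum_cons, List.sum_nil, add_zero] at hr
    show (if r ≤ w then 0 else crkPick [] (r - w) + 1) < 1
    rw [if_pos hr]; exact Nat.zero_lt_one
  | w, w' :: ws, r, hr => by
    show (if r ≤ w then 0 else crkPick (w' :: ws) (r - w) + 1) < (w :: w' :: ws).length
    split_ifs with h
    · simp
    · have : crkPick (w' :: ws) (r - w) < (w' :: ws).length :=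
        crk_pick_lt_length w' ws (r - w) (by simp only [List.sum_cons] at hr ⊢; linarith)
      simpa using this

/-- Prefix sums are monotone under nonnegative weights and bounded by the total. [folklore] -/
theorem crk_cum_succ_le_sum (ws : List ℝ) (hw : ∀ w ∈ ws, 0 ≤ w) (j : ℕ) (hj : j < ws.length) :
    0 ≤ crkCum ws j ∧ crkCum ws j + ws.getD j 0 = crkCum ws (j + 1) ∧ crkCum ws (j + 1) ≤ ws.sum := by
  refine ⟨List.sum_nonneg fun x hx => hw x (List.mem_of_mem_take hx), ?_, ?_⟩
  · simp only [crkCum]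
    rw [List.take_add_one, List.sum_append]
    congr 1
    rw [List.getD_eq_getElem?_getD, List.getElem?_eq_getElem hj]
    simp
  · simp only [crkCum]
    conv_rhs => rw [← List.take_append_drop (j + 1) ws]
    rw [List.sum_append]
    have : 0 ≤ (ws.drop (j + 1)).sum := List.sum_nonneg fun x hx => hw x (List.mem_of_mem_drop hx)
    linarith

/-- Joint measurability of the selection in (weights read from a parameter, level). [folklore] -/
theorem crk_measurable_pick {X : Type*} [MeasurableSpace X] :
    ∀ (L : List (X → ℝ)), (∀ f ∈ L, Measurable f) →
      Measurable fun q : X × ℝ => crkPick (L.map fun f => f q.1) q.2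
  | [], _ => by simp only [List.map_nil, crkPick]; exact measurable_const
  | f :: L, hL => by
    have hf : Measurable f := hL f List.mem_cons_self
    have ih := crk_measurable_pick L fun g hg => hL g (List.mem_cons_of_mem _ hg)
    simp only [List.map_cons, crkPick]
    refine Measurable.ite (measurableSet_le measurable_snd (hf.comp measurable_fst)) measurable_const ?_
    exact (ih.comp (measurable_fst.prodMk (measurable_snd.sub (hf.comp measurable_fst)))).add_const _

/-- Joint measurability of the residual level. [folklore] -/
theorem crk_measurable_resid {X : Type*} [MeasurableSpace X] :
    ∀ (L : List (X → ℝ)), (∀ f ∈ L, Measurable f) →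
      Measurable fun q : X × ℝ => crkResid (L.map fun f => f q.1) q.2
  | [], _ => by simp only [List.map_nil, crkResid]; exact measurable_snd
  | f :: L, hL => by
    have hf : Measurable f := hL f List.mem_cons_self
    have ih := crk_measurable_resid L fun g hg => hL g (List.mem_cons_of_mem _ hg)
    simp only [List.map_cons, crkResid]
    refine Measurable.ite (measurableSet_le measurable_snd (hf.comp measurable_fst))
      (measurable_snd.div (hf.comp measurable_fst)) ?_
    exact ih.comp (measurable_fst.prodMk (measurable_snd.sub (hf.comp measurable_fst)))

/-! ## The law of (selection, residual) under a uniform level -/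

/-- Under a uniform level, `{pick = j, resid ≤ s}` has probability `s · w_j` (nonnegative weights of total
mass `1`, `s ∈ [0,1]`). [folklore] -/
theorem crk_measure_pick_resid {R : Type*} [MeasurableSpace R] (μ : Measure R) [IsProbabilityMeasure μ]
    {U : R → ℝ} (hU : Measurable U) (hunif : ∀ c ∈ Icc (0 : ℝ) 1, μ {u | U u ≤ c} = ENNReal.ofReal c)
    (ws : List ℝ) (hw : ∀ w ∈ ws, 0 ≤ w) (hsum : ws.sum = 1) (j : ℕ) (hj : j < ws.length)
    (s : ℝ) (hs0 : 0 ≤ s) (hs1 : s ≤ 1) :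
    μ {u | crkPick ws (U u) = j ∧ crkResid ws (U u) ≤ s} = ENNReal.ofReal (s * ws.getD j 0) := by
  obtain ⟨hc0, hcs, hc1⟩ := crk_cum_succ_le_sum ws hw j hj
  have hwj : 0 ≤ ws.getD j 0 := by
    rw [List.getD_eq_getElem?_getD, List.getElem?_eq_getElem hj]; exact hw _ (List.getElem_mem hj)
  -- the level is a.s. positive
  have hpos : ∀ᵐ u ∂μ, 0 < U u := by
    have h0 : μ {u | U u ≤ 0} = 0 := by rw [hunif 0 ⟨le_rfl, zero_le_one⟩, ENNReal.ofReal_zero]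
    filter_upwards [measure_eq_zero_iff_ae_notMem.1 h0] with u hu
    simpa using hu
  have hae : {u | crkPick ws (U u) = j ∧ crkResid ws (U u) ≤ s} =ᵐ[μ]
      (U ⁻¹' Ioc (crkCum ws j) (crkCum ws j + s * ws.getD j 0) : Set R) := by
    filter_upwards [hpos] with u hu
    have := Set.ext_iff.1 (crk_pick_resid_set ws hw j hj s hs0 hs1) (U u)
    simp only [mem_setOf_eq, hu, true_and] at this
    exact propext this
  rw [measure_congr hae]
  set a := crkCum ws j
  set b := crkCum ws j + s * ws.getD j 0
  have hab : a ≤ b := by simp only [a, b]; nlinarith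
  have hb1 : b ≤ 1 := by
    have : s * ws.getD j 0 ≤ ws.getD j 0 := by nlinarith
    simp only [b]; linarith
  have hpre : (U ⁻¹' Ioc a b : Set R) = {u | U u ≤ b} \ {u | U u ≤ a} := by
    ext u; simp only [mem_preimage, mem_Ioc, mem_sdiff, mem_setOf_eq, not_le]; tauto
  have hsub : {u | U u ≤ a} ⊆ {u | U u ≤ b} := fun u hu => le_trans (show U u ≤ a from hu) hab
  have hma : MeasurableSet {u | U u ≤ a} := hU measurableSet_Iic
  rw [hpre, measure_sdiff hsub hma.nullMeasurableSet (measure_ne_top _ _), hunif b ⟨hc0.trans hab, hb1⟩,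
    hunif a ⟨hc0, hab.trans hb1⟩, ← ENNReal.ofReal_sub _ hc0]
  congr 1; simp only [b]; ring



/-! ## The eight values of a middle row -/

/-- Boolean reading of the three middle bits of row `0`: colour of `(i+1, 0)`, flags of `(i, 0)`, `(i+1, 0)`.
[folklore] -/
def rowBool (i : ℤ) (x : Obs) : Bool × Bool × Bool :=
  (decide ((![i + 1, 0] : Site 2) ∈ x.1), decide ((![i, 0] : Site 2) ∈ x.2), decide ((![i + 1, 0] : Site 2) ∈ x.2))

/-- Booleans back to propositions. [folklore] -/
def toProp (b : Bool × Bool × Bool) : Prop × Prop × Prop := (b.1 = true, b.2.1 = true, b.2.2 = true)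

/-- A `decide`d coordinate proposition is measurable. [folklore] -/
theorem crk_measurable_decide {X : Type*} [MeasurableSpace X] {P : X → Prop} (hP : Measurable P) :
    Measurable fun x => decide (P x) := by
  refine measurable_to_countable' fun b => ?_
  have : (fun x => decide (P x)) ⁻¹' {b} = {x | P x ↔ (b = true)} := by ext x; cases b <;> simp
  rw [this]; exact measurableSet_setOf.2 (hP.iff measurable_const)

/-- `rowBool` is measurable. [folklore] -/
theorem measurable_rowBool (i : ℤ) : Measurable (rowBool i) :=
  (crk_measurable_decide ((measurable_set_mem _).comp measurable_fst)).prodMk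
    ((crk_measurable_decide ((measurable_set_mem _).comp measurable_snd)).prodMk
      (crk_measurable_decide ((measurable_set_mem _).comp measurable_snd)))

/-- `setMid` only reads its bits up to logical equivalence. [folklore] -/
theorem setMid_congr_bits (i y : ℤ) (z : Obs) (B B' : Prop × Prop × Prop)
    (h1 : B.1 ↔ B'.1) (h2 : B.2.1 ↔ B'.2.1) (h3 : B.2.2 ↔ B'.2.2) : setMid i y z B = setMid i y z B' := by
  have e1 : B.1 = B'.1 := propext h1
  have e2 : B.2.1 = B'.2.1 := propext h2
  have e3 : B.2.2 = B'.2.2 := propext h3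
  simp only [setMid, e1, e2, e3]

/-- Overwriting row `0` of `x` by the Boolean reading of its own bits does nothing. [folklore] -/
theorem setMid_toProp_rowBool (i : ℤ) (x : Obs) : setMid i 0 x (toProp (rowBool i x)) = x := by
  rw [setMid_congr_bits i 0 x (toProp (rowBool i x)) (rowBits i 0 x), setMid_rowBits]
  · simp [toProp, rowBool, rowBits]
  · simp [toProp, rowBool, rowBits]
  · simp [toProp, rowBool, rowBits]

/-- The fixed enumeration of the eight row values. [folklore] -/
def crkVals : List (Bool × Bool × Bool) :=
  [(false, false, false), (false, false, true), (false, true, false), (false, true, true),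
   (true, false, false), (true, false, true), (true, true, false), (true, true, true)]

/-- The enumeration has no duplicates. [folklore] -/
theorem crkVals_nodup : crkVals.Nodup := by decide

/-- The enumeration is exhaustive. [folklore] -/
theorem mem_crkVals (b : Bool × Bool × Bool) : b ∈ crkVals := by
  obtain ⟨b1, b2, b3⟩ := b
  cases b1 <;> cases b2 <;> cases b3 <;> decide

/-- Sums over the eight row values as list sums. [folklore] -/
theorem crk_sum_eq_listSum (f : Bool × Bool × Bool → ℝ) : ∑ b, f b = (crkVals.map f).sum := by
  rw [← List.sum_toFinset _ crkVals_nodup]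
  congr 1
  ext b; simp [mem_crkVals]


/-! ## The row sampler of a kernel: quantile of the eight weights, with residual level -/

section Sampler

variable (k : (Obs × Set (Site 2 × Site 2)) × Obs → Bool × Bool × Bool → ℝ)

/-- The eight weights of the kernel at a statistic value, in the fixed order. [folklore] -/
def crkWeights (t : (Obs × Set (Site 2 × Site 2)) × Obs) : List ℝ := crkVals.map (k t)

/-- THE ROW SAMPLER: the row value selected by the level. [folklore] -/
def crkQ (q : ((Obs × Set (Site 2 × Site 2)) × Obs) × ℝ) : Bool × Bool × Bool :=
  crkVals.getD (crkPick (crkWeights k q.1) q.2) (true, true, true)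

/-- The residual level of the row sampler. [folklore] -/
def crkR (q : ((Obs × Set (Site 2 × Site 2)) × Obs) × ℝ) : ℝ := crkResid (crkWeights k q.1) q.2

/-- The weights as an evaluated list of measurable functions. [folklore] -/
theorem crkWeights_eq (t : (Obs × Set (Site 2 × Site 2)) × Obs) :
    crkWeights k t = (crkVals.map fun b => fun t' => k t' b).map fun f => f t := by
  simp [crkWeights, List.map_map, Function.comp_def]

/-- The row sampler is jointly measurable. [folklore] -/
theorem measurable_crkQ (hk : ∀ b, Measurable fun t => k t b) : Measurable (crkQ k) := by
  have h1 : Measurable fun q : ((Obs × Set (Site 2 × Site 2)) × Obs) × ℝ => crkPick (crkWeights k q.1) q.2 := by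
    simp_rw [crkWeights_eq]
    exact crk_measurable_pick _ fun f hf => by
      obtain ⟨b, -, rfl⟩ := List.mem_map.1 hf; exact hk b
  exact (measurable_from_nat (f := fun n : ℕ => crkVals.getD n (true, true, true))).comp h1

/-- The residual level is jointly measurable. [folklore] -/
theorem measurable_crkR (hk : ∀ b, Measurable fun t => k t b) : Measurable (crkR k) := by
  unfold crkR
  simp_rw [crkWeights_eq]
  exact crk_measurable_resid _ fun f hf => by
    obtain ⟨b, -, rfl⟩ := List.mem_map.1 hf; exact hk b

/-- THE ONE-DIMENSIONAL LAW of the row sampler: under a uniform level, at a statistic value where the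
weights form a probability vector, `{row = b, residual ≤ s} ` has probability `s · k t b` for `s ∈ [0,1]`.
[folklore] -/
theorem crk_measure_Q_R {R : Type*} [MeasurableSpace R] (μ : Measure R) [IsProbabilityMeasure μ]
    {U : R → ℝ} (hU : Measurable U) (hunif : ∀ c ∈ Icc (0 : ℝ) 1, μ {u | U u ≤ c} = ENNReal.ofReal c)
    (t : (Obs × Set (Site 2 × Site 2)) × Obs) (h0 : ∀ b, 0 ≤ k t b) (h1 : ∑ b, k t b = 1)
    (b : Bool × Bool × Bool) (s : ℝ) (hs0 : 0 ≤ s) (hs1 : s ≤ 1) :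
    μ {u | crkQ k (t, U u) = b ∧ crkR k (t, U u) ≤ s} = ENNReal.ofReal (s * k t b) := by
  have hw : ∀ w ∈ crkWeights k t, 0 ≤ w := by
    intro w hw'; obtain ⟨b', -, rfl⟩ := List.mem_map.1 hw'; exact h0 b'
  have hsum : (crkWeights k t).sum = 1 := by rw [crkWeights, ← crk_sum_eq_listSum]; exact h1
  have hlen : (crkWeights k t).length = 8 := by simp [crkWeights, crkVals]
  -- the index of `b`
  obtain ⟨j, hj, hjb⟩ : ∃ j, ∃ hj : j < crkVals.length, crkVals[j] = b := List.getElem_of_mem (mem_crkVals b)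
  have hj8 : j < (crkWeights k t).length := by rw [hlen]; simpa [crkVals] using hj
  -- a.s. the level is in `(0, 1]`, so the selected index is `< 8`
  have hle1 : ∀ᵐ u ∂μ, U u ≤ 1 := by
    have : μ {u | U u ≤ 1} = 1 := by rw [hunif 1 ⟨zero_le_one, le_rfl⟩, ENNReal.ofReal_one]
    exact (ae_iff_measure_eq (hU measurableSet_Iic).nullMeasurableSet).2 (by simpa using this)
  have hae : {u | crkQ k (t, U u) = b ∧ crkR k (t, U u) ≤ s} =ᵐ[μ]
      ({u | crkPick (crkWeights k t) (U u) = j ∧ crkResid (crkWeights k t) (U u) ≤ s} : Set R) := by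
    filter_upwards [hle1] with u hu
    have hlt : crkPick (crkWeights k t) (U u) < crkVals.length := by
      have := crk_pick_lt_length ((crkWeights k t).headD 0) ((crkWeights k t).tail) (U u)
      have hcons : (crkWeights k t).headD 0 :: (crkWeights k t).tail = crkWeights k t := by
        simp [crkWeights, crkVals]
      rw [hcons] at this
      have h' := this (by rw [hsum]; exact hu)
      rw [hlen] at h'; simpa [crkVals] using h'
    simp only [crkQ, crkR]
    refine propext (and_congr_left fun _ => ?_)
    rw [List.getD_eq_getElem?_getD, List.getElem?_eq_getElem hlt, Option.getD_some, ← hjb]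
    exact crkVals_nodup.getElem_inj_iff
  rw [measure_congr hae, crk_measure_pick_resid μ hU hunif _ hw hsum j hj8 s hs0 hs1]
  congr 2
  rw [List.getD_eq_getElem?_getD, List.getElem?_eq_getElem hj8, Option.getD_some]
  simp only [crkWeights, List.getElem_map, hjb]

/-- The one-dimensional law for an arbitrary threshold: `{row = b, residual ≤ a}` has probability
`clamp(a) · k t b`, `clamp(a) = max 0 (min a 1)`. [folklore] -/
theorem crk_measure_Q_R' {R : Type*} [MeasurableSpace R] (μ : Measure R) [IsProbabilityMeasure μ]
    {U : R → ℝ} (hU : Measurable U) (hunif : ∀ c ∈ Icc (0 : ℝ) 1, μ {u | U u ≤ c} = ENNReal.ofReal c)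
    (t : (Obs × Set (Site 2 × Site 2)) × Obs) (h0 : ∀ b, 0 ≤ k t b) (h1 : ∑ b, k t b = 1)
    (b : Bool × Bool × Bool) (a : ℝ) :
    μ {u | crkQ k (t, U u) = b ∧ crkR k (t, U u) ≤ a} = ENNReal.ofReal (max 0 (min a 1) * k t b) := by
  have hw : ∀ w ∈ crkWeights k t, 0 ≤ w := by
    intro w hw'; obtain ⟨b', -, rfl⟩ := List.mem_map.1 hw'; exact h0 b'
  have hsum : (crkWeights k t).sum = 1 := by rw [crkWeights, ← crk_sum_eq_listSum]; exact h1
  -- a.s. the residual lies in `(0, 1]`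
  have hres : ∀ (ws : List ℝ), (∀ w ∈ ws, 0 ≤ w) → ∀ r : ℝ, 0 < r → r ≤ ws.sum →
      0 < crkResid ws r ∧ crkResid ws r ≤ 1 := by
    intro ws
    induction ws with
    | nil => intro _ r hr hr'; simp at hr'; exact absurd hr' (not_le.2 hr)
    | cons w ws ih =>
      intro hws r hr hr'
      show 0 < (if r ≤ w then r / w else crkResid ws (r - w)) ∧ (if r ≤ w then r / w else crkResid ws (r - w)) ≤ 1
      split_ifs with h
      · have hwpos : 0 < w := hr.trans_le h
        exact ⟨div_pos hr hwpos, (div_le_one hwpos).2 h⟩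
      · exact ih (fun w' hw' => hws w' (List.mem_cons_of_mem _ hw')) (r - w) (by linarith)
          (by simp only [List.sum_cons] at hr'; linarith)
  have hpos : ∀ᵐ u ∂μ, 0 < U u := by
    have h0' : μ {u | U u ≤ 0} = 0 := by rw [hunif 0 ⟨le_rfl, zero_le_one⟩, ENNReal.ofReal_zero]
    filter_upwards [measure_eq_zero_iff_ae_notMem.1 h0'] with u hu
    simpa using hu
  have hle1 : ∀ᵐ u ∂μ, U u ≤ 1 := by
    have : μ {u | U u ≤ 1} = 1 := by rw [hunif 1 ⟨zero_le_one, le_rfl⟩, ENNReal.ofReal_one]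
    exact (ae_iff_measure_eq (hU measurableSet_Iic).nullMeasurableSet).2 (by simpa using this)
  have hR : ∀ᵐ u ∂μ, 0 < crkR k (t, U u) ∧ crkR k (t, U u) ≤ 1 := by
    filter_upwards [hpos, hle1] with u hu hu'
    exact hres _ hw (U u) hu (by rw [hsum]; exact hu')
  rcases le_or_gt a 0 with ha | ha
  · -- empty a.s.
    have : max 0 (min a 1) = 0 := by rw [max_eq_left]; exact (min_le_left _ _).trans ha
    rw [this, zero_mul, ENNReal.ofReal_zero]
    have hsub : {u | crkQ k (t, U u) = b ∧ crkR k (t, U u) ≤ a} ⊆ {u | ¬ a < crkR k (t, U u)} :=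
      fun u hu => not_lt.2 hu.2
    refine measure_mono_null hsub (ae_iff.1 ?_)
    filter_upwards [hR] with u hu
    exact ha.trans_lt hu.1
  rcases le_or_gt a 1 with ha1 | ha1
  · have : max 0 (min a 1) = a := by rw [min_eq_left ha1, max_eq_right ha.le]
    rw [this]; exact crk_measure_Q_R k μ hU hunif t h0 h1 b a ha.le ha1
  · have : max 0 (min a 1) = 1 := by rw [min_eq_right ha1.le, max_eq_right zero_le_one]
    rw [this]
    have hae : {u | crkQ k (t, U u) = b ∧ crkR k (t, U u) ≤ a} =ᵐ[μ]
        ({u | crkQ k (t, U u) = b ∧ crkR k (t, U u) ≤ 1} : Set R) := by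
      filter_upwards [hR] with u hu
      exact propext (and_congr_right fun _ => ⟨fun _ => hu.2, fun _ => hu.2.trans ha1.le⟩)
    rw [measure_congr hae]; exact crk_measure_Q_R k μ hU hunif t h0 h1 b 1 zero_le_one le_rfl

end Sampler



/-! ## The registered form -/

/-- THE LAW OF THE ROW SAMPLER (registered sub-goal `crk_rowSampler_law`): under a uniform level `U` and at a
statistic value where `k t ·` is a probability vector, the sampled row `crkQ` and the residual level `crkR`
satisfy `μ {crkQ = b, crkR ≤ a} = max 0 (min a 1) · k t b` — the sampled row has law `k t` and the residual
level is uniform on `[0,1]` independently of it. [folklore] -/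
theorem crk_rowSampler_law : ∀ (k : (Obs × Set (Site 2 × Site 2)) × Obs → Bool × Bool × Bool → ℝ)
    {R : Type*} [MeasurableSpace R] (μ : MeasureTheory.Measure R) [MeasureTheory.IsProbabilityMeasure μ] (U : R → ℝ),
    Measurable U → (∀ c ∈ Set.Icc (0 : ℝ) 1, μ {u | U u ≤ c} = ENNReal.ofReal c) →
    ∀ (t : (Obs × Set (Site 2 × Site 2)) × Obs), (∀ b, 0 ≤ k t b) → ∑ b, k t b = 1 →
    ∀ (b : Bool × Bool × Bool) (a : ℝ),
      μ {u | crkQ k (t, U u) = b ∧ crkR k (t, U u) ≤ a} = ENNReal.ofReal (max 0 (min a 1) * k t b) :=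
  fun k _ _ μ _ _ hU hunif t h0 h1 b a => crk_measure_Q_R' k μ hU hunif t h0 h1 b a

end Summit.CriticalPhenomena.CardyFormulaZ2.Theorems.IKLinearTransport.PinnedDiagramExchange
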